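import Mathlib
import HarnessLib
import Summits.NavierStokesRegularity.NavierStokesRegularity.Theorems.UnthreadedDoorNetFluxNF1aDeltaDanskin
import Summits.NavierStokesRegularity.NavierStokesRegularity.Theorems.UnthreadedDoorNetFluxNF1aDeltaLipschitz
import Summits.NavierStokesRegularity.NavierStokesRegularity.Theorems.UnthreadedDoorNetFluxNF1aSliceLevelLipSharpen

/-!
# Route `UnthreadedDoor`, crux `PoloidalLiouville` (stmt-NavierStokesRegularity-1222), WALL W1 — second-stratum line «height-head»
# (ns-idea-14 g5, `Lines/height_head.lean`): stub HH-2 / K2 `ExtremalHeadEMFOfLevelLip`, PROVED (by name)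

`NF1a.extremalHeadEMF_of_levelLip` has the body of the sketch's `HeightHead.ExtremalHeadEMFOfLevelLip` (sketch v3.2 l.223) VERBATIM over the
Theorems-side objects: the binders of `ExtremalHeadEMF` with hypothesis 6 «every sphere saddle-free» replaced by the SLICE LEVEL-LIPSCHITZ
property with the fixed constant `r · V t`, and conclusions (i)–(v) unchanged.  Assembly of the (Δ) lemmas:
(i) `NF1a.exists_headDiff_fun` (p674443) · (iii) `NF1a.lipschitzOnWith_headDiff_of_sliceLevelLip`, (iv) `NF1a.abs_headDiff_le_netFlux_of_sliceLevelLip`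
(`…NF1aDeltaLipschitz`) · (v) `NF1a.ae_deriv_headDiff_le_of_sliceLevelLip` (p674776) · (ii) `NF1a.continuousOn_headDiff_of_sliceLevelLip`
(p674905) fed the FLEXIBLE slice property, which `NF1a.sliceLevelLip_sharpen` (`…NF1aSliceLevelLipSharpen`; Sard on the sphere p672064 +
absolute continuity) derives from hypothesis 6 and the tangential relation.  So hinge (a) holds on ANY stratum where the slice property is
available — unimodality is not used.  In the line: `theorem stub_extremalHeadEMFOfLevelLip : ExtremalHeadEMFOfLevelLip :=
Theorems.PoloidalLiouville.NetFlux.NF1a.extremalHeadEMF_of_levelLip` (definitional unfolding; `sphArgmax`/`sphArgmin`/`radDeriv` are the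
§4-guarded twins).

HONEST LABEL: one stub of a SECOND-STRATUM line (conditional programme: K1⁺ `LevelLipschitzOfAnalyticIsolated` = ARM A's HH-1, Literature fact
`NSSpatialAnalyticity`, gauge lemma HH-6 still open); `PoloidalLiouville` (1222), C⁻, W1 and the summit stay OPEN; NO Navier–Stokes
regularity statement is proved.  `--supports stmt-NavierStokesRegularity-1222 --as helper`.  [folklore]
-/

noncomputable section

-- the summit and its single sub-problem share the name (CONVENTIONS §1)
set_option linter.dupNamespace false

open Set Function Filter Topology InnerProductSpace MeasureTheory
open scoped RealInnerProductSpace NNReal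

namespace Summit.NavierStokesRegularity.NavierStokesRegularity.Theorems.PoloidalLiouville.NetFlux.NF1a

open Literature.Analysis Literature.Analysis.FluidPDE

/-- **K2 / HH-2 `ExtremalHeadEMFOfLevelLip`, proved**: hinge (a) of the netflux line with «every sphere saddle-free» replaced by the slice
level-Lipschitz property `|P t x − P t y| ≤ (r·V t)|T t x − T t y|` on every sphere — the extremal head difference exists with (i)
choice-independence, (ii) joint continuity, (iii) local Lipschitz continuity in `r`, (iv) the EMF bound `|I| ≤ V·netFlux`, (v) the a.e.
Danskin slope bound.  Assembly of the (Δ) lemmas; the flexible slice property needed by (ii) comes from `sliceLevelLip_sharpen`.  No NS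
statement is involved. [folklore] -/
theorem extremalHeadEMF_of_levelLip :
    ∀ (v : ℝ → E3 → E3) (x₀ : E3) (T P : ℝ → E3 → ℝ) (V : ℝ → ℝ) (t₀ : ℝ),
    ContDiffOn ℝ (⊤ : ℕ∞) (uncurry v) (Ioo t₀ 0 ×ˢ univ) →
    ContDiffOn ℝ (⊤ : ℕ∞) (uncurry T) (Ioo t₀ 0 ×ˢ ({x₀}ᶜ : Set E3)) →
    (∀ t ∈ Ioo t₀ 0, ContDiffOn ℝ 1 (P t) ({x₀}ᶜ : Set E3)) →
    (∀ t ∈ Ioo t₀ 0, ∀ x, ‖v t x‖ ≤ V t) →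
    (∀ t ∈ Ioo t₀ 0, ∀ x, x ≠ x₀ →
        cross (gradient (P t) x - (inner ℝ (v t x) (x - x₀)) • gradient (T t) x) (x - x₀) = 0) →
    (∀ t ∈ Ioo t₀ 0, ∀ r > 0, ∀ x ∈ Metric.sphere x₀ r, ∀ y ∈ Metric.sphere x₀ r,
        |P t x - P t y| ≤ (r * V t) * |T t x - T t y|) →
    ∃ I : ℝ → ℝ → ℝ,
      (∀ t ∈ Ioo t₀ 0, ∀ r > 0, ∀ xp ∈ sphArgmax (T t) x₀ r, ∀ xm ∈ sphArgmin (T t) x₀ r,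
          I t r = P t xp - P t xm) ∧
      ContinuousOn (uncurry I) (Ioo t₀ 0 ×ˢ Ioi 0) ∧
      (∀ t ∈ Ioo t₀ 0, ∀ a b : ℝ, 0 < a → a < b → ∃ L : NNReal, LipschitzOnWith L (I t) (Icc a b)) ∧
      (∀ t ∈ Ioo t₀ 0, ∀ r > 0, |I t r| ≤ V t * netFlux (T t) x₀ r) ∧
      (∀ t ∈ Ioo t₀ 0, ∀ᵐ r : ℝ, 0 < r →
          deriv (I t) r ≤ sSup (radDeriv (P t) x₀ '' sphArgmax (T t) x₀ r)
                          - sInf (radDeriv (P t) x₀ '' sphArgmin (T t) x₀ r)) := by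
  intro v x₀ T P V t₀ hv hT hP hV hcross hfix
  -- slice data
  have hvt : ∀ t ∈ Ioo t₀ 0, ContDiff ℝ (⊤ : ℕ∞) (v t) := fun t ht => contDiff_slice_of_window hv ht
  have hTt : ∀ t ∈ Ioo t₀ 0, ContDiffOn ℝ (⊤ : ℕ∞) (T t) ({x₀}ᶜ : Set E3) := fun t ht => contDiffOn_slice_compl hT ht
  have hT1 : ∀ t ∈ Ioo t₀ 0, ContDiffOn ℝ 1 (T t) ({x₀}ᶜ : Set E3) := fun t ht =>
    (hTt t ht).of_le (by exact_mod_cast le_top)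
  have hV0 : ∀ t ∈ Ioo t₀ 0, 0 ≤ V t := fun t ht => (norm_nonneg _).trans (hV t ht x₀)
  -- the slice property with constant `V t · r`
  have hSLL : ∀ t ∈ Ioo t₀ 0, ∀ r > 0, ∀ x ∈ Metric.sphere x₀ r, ∀ y ∈ Metric.sphere x₀ r,
      |P t x - P t y| ≤ V t * r * |T t x - T t y| := fun t ht r hr x hx y hy => by
    rw [mul_comm (V t) r]; exact hfix t ht r hr x hx y hy
  -- the flexible slice property (sharpening via Sard + absolute continuity)
  have hflex : ∀ t ∈ Ioo t₀ 0, ∀ r > 0, ∀ L : ℝ, (∀ x ∈ Metric.sphere x₀ r, |⟪v t x, x - x₀⟫| ≤ L) →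
      ∀ x ∈ Metric.sphere x₀ r, ∀ y ∈ Metric.sphere x₀ r, |P t x - P t y| ≤ L * |T t x - T t y| :=
    fun t ht r hr L hL =>
      sliceLevelLip_sharpen (f := T t) (g := P t) (μ := fun x => ⟪v t x, x - x₀⟫) hr (hTt t ht) (hP t ht)
        (fun x hx => hcross t ht x (ne_center_of_mem_sphere hr hx)) hL (hfix t ht r hr)
  -- the head difference with property (i)
  obtain ⟨I, hI⟩ := exists_headDiff_fun T P x₀ t₀ (Λ := fun t r => r * V t) hfix
  refine ⟨I, hI, ?_, ?_, ?_, ?_⟩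
  · -- (ii)
    exact continuousOn_headDiff_of_sliceLevelLip hv hT hP hcross hflex hI
  · -- (iii)
    intro t ht a b ha hab
    exact lipschitzOnWith_headDiff_of_sliceLevelLip (hT1 t ht) (hP t ht) (hV0 t ht) (hSLL t ht)
      (fun r hr => hI t ht r hr) a b ha hab
  · -- (iv)
    intro t ht r hr
    exact abs_headDiff_le_netFlux_of_sliceLevelLip (hTt t ht).continuousOn (hSLL t ht) (fun r hr => hI t ht r hr) hr
  · -- (v)
    intro t ht
    exact ae_deriv_headDiff_le_of_sliceLevelLip (hT1 t ht) (hP t ht) (hV0 t ht) (hSLL t ht) (fun r hr => hI t ht r hr)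

end Summit.NavierStokesRegularity.NavierStokesRegularity.Theorems.PoloidalLiouville.NetFlux.NF1a

end
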